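import Summits.QuantumFields.YangMills.Theorems.FemtoTransferGapGramMoments
import Summits.QuantumFields.YangMills.Theorems.FemtoTransferGapPhysL2
import Mathlib.MeasureTheory.Function.ContinuousMapDense
import HarnessLib

/-!
# The Wilson transfer form of `SU(2)` is STRICTLY positive: `‖ψ‖² > 0 ⟹ ⟨ψ, K_β ψ⟩ > 0` for `β > 0`

Support module of the `FemtoTransferGap` group (fleet service by seat ym-infvol-p2; route `LuscherReduction`, bears on crux `RunningReduction`
stmt-QuantumFields-19978 and crux `OneSiteLevels` stmt-QuantumFields-20007).  `FemtoTransferGapPositivity` proves that the transfer quadratic form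
`⟨ψ, K_β ψ⟩ = ∫∫ ψ(U) K_β(U,V) ψ(V)` is non-negative (`β ≥ 0`).  Here we prove that it is NON-DEGENERATE for `β > 0` — Lüscher's theorem that the
temporal-gauge transfer matrix of Wilson's lattice gauge theory is a STRICTLY positive operator [cite: Luscher1977, §3] — in the tree's currency:
`ψ(U)K_β(U,V)ψ(V) = Φ(U) e^{βT(U,V)} Φ(V)` with `Φ = ψ·e^{−(β/2)S}` PHYSICAL (`isPhys_mul_expAction`) and `T` the Gram kernel of the real features `suFeature`
(`FemtoTransferGapPositivity`), which separate configurations (`suFeature_separates`); so `⟨ψ,K_βψ⟩ = 0` forces every feature-monomial moment of `Φ`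
to vanish (`FemtoTransferGapGramMoments` §1), hence `∫ Φ h = 0` for all continuous `h` (ibid. §2, Stone–Weierstrass), hence `toL2 Φ ⊥` the dense range
of `C(X,ℝ) → L²` (`ContinuousMap.toLp_denseRange`), `toL2 Φ = 0`, `‖Φ‖² = 0`, and `‖ψ‖² ≤ e^{βS_max}‖Φ‖² = 0`:

**`qform_su2Rep_pos : 0 < β → IsPhys ψ → 0 < l2 ψ ψ → 0 < qform su2Rep β ψ ψ`**, `qform_su2Rep_eq_zero_iff`, `rayleigh_su2Rep_pos`.

Consequence (companion file `FemtoTransferGapLevelsPos`): every min–max transfer value is strictly positive, `0 < levelValue su2Rep L β k` for ALL `k`,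
`L ≥ 1`, `β > 0` — so the spectral attainment theorems `PhysL2.exists_isPhys_eigenfamily(_dominating)` apply unconditionally on the femto window.

HONEST FRAMING: fixed-lattice functional analysis of the femto rung R2b1; nothing here is infinite volume, a mass gap or Clay.
References: M. Lüscher, Commun. Math. Phys. 54 (1977) 283, §3 [cite: Luscher1977]; K. Osterwalder, E. Seiler, Ann. Phys. 110 (1978) 440, §2
[cite: OsterwalderSeiler1978]; M. Reed, B. Simon IV (1978) XIII.12 [cite: ReedSimonIV1978].
-/

set_option autoImplicit false

noncomputable section

open MeasureTheory Filter Topology Real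
open scoped Nat
open Literature.MathematicalPhysics.QuantumFieldTheory
open Literature.MathematicalPhysics.QuantumLattice
open Literature.Analysis.OperatorTheory.YMMatrixModel

namespace Summit.QuantumFields.YangMills.Theorems.FemtoTransferGap

/-! ### The Wilson transfer form of `SU(2)` is non-degenerate -/

section Wilson

variable {L : ℕ} [NeZero L]

/-- The real features of `SU(2)` configurations separate configurations: two distinct link configurations differ in some matrix entry of some
link, hence in its real or imaginary part. [folklore] -/
theorem suFeature_separates {n : ℕ} (U V : GaugeConfig 3 L (Matrix.specialUnitaryGroup (Fin n) ℂ)) (hUV : U ≠ V) :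
    ∃ a, suFeature n L a U ≠ suFeature n L a V := by
  by_contra hcon
  push Not at hcon
  apply hUV
  funext e
  apply Subtype.ext
  ext i j
  apply Complex.ext
  · simpa [suFeature] using hcon (e, (i, j), true)
  · simpa [suFeature] using hcon (e, (i, j), false)

/-- The dressed test function `Φ = ψ · e^{−(β/2) S}` of a physical `ψ` is physical (the Wilson action is gauge and centre-twist invariant).
[cite: Luscher1977, §3] -/
theorem isPhys_mul_expAction (β : ℝ) {ψ : GaugeConfig 3 L SU2 → ℝ} (hψ : IsPhys ψ) :
    IsPhys (fun U => ψ U * Real.exp (-(β / 2) * wilsonAction su2Rep U)) := by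
  haveI : SecondCountableTopology SU2 := secondCountableTopology_su2
  have hw_cont : Continuous fun U : GaugeConfig 3 L SU2 => Real.exp (-(β / 2) * wilsonAction su2Rep U) :=
    Real.continuous_exp.comp (continuous_const.mul (continuous_wilsonAction su2Rep continuous_su2Rep))
  obtain ⟨W, hW⟩ := (isCompact_range hw_cont).bddAbove
  obtain ⟨C, hC⟩ := hψ.bounded
  refine ⟨hψ.measurable.mul hw_cont.measurable, ⟨C * W, fun U => ?_⟩, fun g U => ?_, fun k z hz U => ?_⟩
  · rw [abs_mul, abs_of_pos (Real.exp_pos _)]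
    exact mul_le_mul (hC U) (hW (Set.mem_range_self U)) (Real.exp_pos _).le ((abs_nonneg _).trans (hC U))
  · simp only [hψ.gaugeInv g U, wilsonAction_gaugeTransform]
  · simp only [hψ.zeroFlux k z hz U, wilsonAction_twist_of_mem_center su2Rep k hz]

/-- **The `SU(2)` transfer form as a dressed Gram exponential** (the integrand identity of `qform_self_nonneg_fundamentalRep`, product form):
`⟨ψ, K_β ψ⟩ = ∫ Φ(U) e^{β ∑ₐ gₐ(U) gₐ(V)} Φ(V) d(μ⊗μ)`, `Φ = ψ e^{−(β/2)S}`, `gₐ = suFeature`. [cite: OsterwalderSeiler1978, §2] -/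
theorem qform_su2Rep_eq_integral_prod_exp_gram (β : ℝ) {ψ : GaugeConfig 3 L SU2 → ℝ} (hψ : IsPhys ψ) :
    qform su2Rep β ψ ψ =
      ∫ p, (ψ p.1 * Real.exp (-(β / 2) * wilsonAction su2Rep p.1))
        * Real.exp (β * ∑ a, suFeature 2 L a p.1 * suFeature 2 L a p.2)
        * (ψ p.2 * Real.exp (-(β / 2) * wilsonAction su2Rep p.2)) ∂(configMeasure SU2 L).prod (configMeasure SU2 L) := by
  haveI : SecondCountableTopology (Matrix (Fin 2) (Fin 2) ℂ) := inferInstanceAs (SecondCountableTopology (Fin 2 → Fin 2 → ℂ))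
  haveI : SecondCountableTopology SU2 := secondCountableTopology_su2
  have hΦ := isPhys_mul_expAction β hψ
  obtain ⟨C, hΦb⟩ := hΦ.bounded
  have hgm : ∀ a, Measurable (suFeature 2 L a) := fun a => (continuous_suFeature L a).measurable
  have hgb : ∀ a U, |suFeature 2 L a U| ≤ 1 := abs_suFeature_le_one L
  have hTm := measurable_gram _ hgm
  have hTb := fun p : GaugeConfig 3 L SU2 × GaugeConfig 3 L SU2 => abs_gram_le (suFeature 2 L) zero_le_one hgb p.1 p.2
  have hK : ∀ U V, ψ U * transferKernel su2Rep β U V * ψ V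
      = (ψ U * Real.exp (-(β / 2) * wilsonAction su2Rep U))
        * Real.exp (β * ∑ a, suFeature 2 L a U * suFeature 2 L a V)
        * (ψ V * Real.exp (-(β / 2) * wilsonAction su2Rep V)) := by
    intro U V
    rw [← timeCoupling_fundamentalRep_eq_gram]
    simp only [transferKernel]
    rw [show β * timeCoupling su2Rep U V - β / 2 * (wilsonAction su2Rep U + wilsonAction su2Rep V)
        = β * timeCoupling su2Rep U V + -(β / 2) * wilsonAction su2Rep U + -(β / 2) * wilsonAction su2Rep V by ring,
      Real.exp_add, Real.exp_add]
    ring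
  have hint : Integrable (fun p : GaugeConfig 3 L SU2 × GaugeConfig 3 L SU2 =>
      (ψ p.1 * Real.exp (-(β / 2) * wilsonAction su2Rep p.1))
        * Real.exp (β * ∑ a, suFeature 2 L a p.1 * suFeature 2 L a p.2)
        * (ψ p.2 * Real.exp (-(β / 2) * wilsonAction su2Rep p.2)))
      ((configMeasure SU2 L).prod (configMeasure SU2 L)) := by
    refine integrable_sandwich (configMeasure SU2 L)
      (H := fun p => Real.exp (β * ∑ a, suFeature 2 L a p.1 * suFeature 2 L a p.2)) (hTm.const_mul β).exp
      (R := Real.exp (|β| * (Fintype.card (Edge 3 L × (Fin 2 × Fin 2) × Bool) * 1 ^ 2))) (fun p => ?_)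
      hΦ.measurable hΦb
    show |Real.exp (β * ∑ a, suFeature 2 L a p.1 * suFeature 2 L a p.2)| ≤ _
    rw [abs_of_pos (Real.exp_pos _)]
    refine Real.exp_le_exp.mpr ((le_abs_self _).trans ?_)
    rw [abs_mul]
    exact mul_le_mul_of_nonneg_left (hTb p) (abs_nonneg _)
  unfold qform
  simp_rw [hK]
  exact (integral_prod _ hint).symm

/-- **STRICT POSITIVITY of the `SU(2)` Wilson transfer form** (Lüscher 1977): for `β > 0` and every physical zero-flux test function `ψ` with
`‖ψ‖² > 0`, `⟨ψ, K_β ψ⟩ > 0`.  Proof: if `⟨ψ,K_βψ⟩ = 0` then by §1 every feature-monomial moment of `Φ = ψ e^{−(β/2)S}` vanishes, by §2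
(Stone–Weierstrass; the features separate configurations) `∫ Φ h = 0` for every continuous `h`, so `toL2 Φ` is orthogonal to the dense range of
`C(X,ℝ) → L²` and vanishes, `‖Φ‖² = 0`, and `‖ψ‖² ≤ e^{βS_max} ‖Φ‖² = 0`. [cite: Luscher1977, §3] [cite: ReedSimonIV1978, Thm. XIII.12] -/
theorem qform_su2Rep_pos {β : ℝ} (hβ : 0 < β) {ψ : GaugeConfig 3 L SU2 → ℝ} (hψ : IsPhys ψ) (hpos : 0 < l2 ψ ψ) :
    0 < qform su2Rep β ψ ψ := by
  haveI : SecondCountableTopology (Matrix (Fin 2) (Fin 2) ℂ) := inferInstanceAs (SecondCountableTopology (Fin 2 → Fin 2 → ℂ))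
  haveI : SecondCountableTopology SU2 := secondCountableTopology_su2
  refine (qform_su2Rep_self_nonneg hβ.le hψ).lt_of_ne fun h0 => ?_
  -- the dressed function `Φ` and its bounds
  set Φ : GaugeConfig 3 L SU2 → ℝ := fun U => ψ U * Real.exp (-(β / 2) * wilsonAction su2Rep U) with hΦdef
  have hΦ : IsPhys Φ := isPhys_mul_expAction β hψ
  obtain ⟨C, hΦb⟩ := hΦ.bounded
  have hC : 0 ≤ C := (abs_nonneg _).trans (hΦb fun _ => 1)
  have hgm : ∀ a, Measurable (suFeature 2 L a) := fun a => (continuous_suFeature L a).measurable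
  have hgb : ∀ a U, |suFeature 2 L a U| ≤ 1 := abs_suFeature_le_one L
  -- §1: all monomial moments of `Φ` vanish
  have hexp0 : ∫ p, Φ p.1 * Real.exp (β * ∑ a, suFeature 2 L a p.1 * suFeature 2 L a p.2) * Φ p.2
      ∂(configMeasure SU2 L).prod (configMeasure SU2 L) = 0 := by
    rw [hΦdef, ← qform_su2Rep_eq_integral_prod_exp_gram β hψ]; exact h0.symm
  have hmom : ∀ (n : ℕ) (q : Fin n → Edge 3 L × (Fin 2 × Fin 2) × Bool),
      ∫ U, Φ U * ∏ k, suFeature 2 L (q k) U ∂configMeasure SU2 L = 0 := by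
    classical
    exact integral_mul_prod_eq_zero_of_exp_gram (configMeasure SU2 L) (suFeature 2 L) hgm zero_le_one hgb Φ
      hΦ.measurable hC hΦb hβ hexp0
  -- §2: `∫ Φ h = 0` for every continuous `h`
  have horth : ∀ f : C(GaugeConfig 3 L SU2, ℝ), ∫ U, Φ U * f U ∂configMeasure SU2 L = 0 :=
    integral_mul_eq_zero_of_forall_monomial (configMeasure SU2 L)
      (fun a => ⟨suFeature 2 L a, continuous_suFeature L a⟩) (fun U V hUV => suFeature_separates U V hUV)
      Φ hΦ.measurable hΦb hmom
  -- §3: `toL2 Φ ⊥` the dense range of `C(X,ℝ) → L²`, hence `toL2 Φ = 0` and `‖Φ‖² = 0`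
  haveI : TopologicalSpace.PseudoMetrizableSpace (Matrix (Fin 2) (Fin 2) ℂ) :=
    inferInstanceAs (TopologicalSpace.PseudoMetrizableSpace (Fin 2 → Fin 2 → ℂ))
  haveI : TopologicalSpace.PseudoMetrizableSpace SU2 := inferInstance
  set ΦP : physSubmodule L := ⟨Φ, hΦ⟩ with hΦP
  have hdense := ContinuousMap.toLp_denseRange ℝ (configMeasure SU2 L) ℝ (p := 2) ENNReal.ofNat_ne_top
  have hzero : PhysL2.toL2 ΦP = 0 := by
    refine hdense.eq_zero_of_inner_right ℝ fun f => ?_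
    rw [real_inner_comm, PhysL2.inner_toL2_left]
    have hae := ContinuousMap.coeFn_toLp (E := ℝ) (p := 2) (μ := configMeasure SU2 L) (𝕜 := ℝ) f
    calc ∫ U, (ΦP : GaugeConfig 3 L SU2 → ℝ) U * (ContinuousMap.toLp 2 (configMeasure SU2 L) ℝ f) U ∂configMeasure SU2 L
        = ∫ U, Φ U * f U ∂configMeasure SU2 L := by
          refine integral_congr_ae ?_
          filter_upwards [hae] with U hU
          rw [hU]
      _ = 0 := horth f
  have hl2Φ : l2 Φ Φ = 0 := by
    have := PhysL2.norm_sq_toL2 ΦP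
    rw [hzero, norm_zero] at this
    simpa using this.symm
  -- `‖ψ‖² ≤ e^{β S_max} ‖Φ‖² = 0`
  have hS_cont : Continuous fun U : GaugeConfig 3 L SU2 => wilsonAction su2Rep U :=
    continuous_wilsonAction su2Rep continuous_su2Rep
  obtain ⟨Smax, hSmax⟩ := (isCompact_range hS_cont).bddAbove
  have hSle : ∀ U, wilsonAction su2Rep U ≤ Smax := fun U => hSmax (Set.mem_range_self U)
  have hw : ∀ U, Real.exp (-(β / 2) * Smax) ≤ Real.exp (-(β / 2) * wilsonAction su2Rep U) := fun U =>
    Real.exp_le_exp.mpr (mul_le_mul_of_nonpos_left (hSle U) (by linarith))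
  set w0 : ℝ := Real.exp (-(β / 2) * Smax) with hw0
  have hw0pos : 0 < w0 := Real.exp_pos _
  have hptw : ∀ U, ψ U * ψ U ≤ (w0 ^ 2)⁻¹ * (Φ U * Φ U) := by
    intro U
    rw [hΦdef]
    have hwU := hw U
    have hψ2 : 0 ≤ ψ U * ψ U := mul_self_nonneg _
    rw [le_inv_mul_iff₀ (pow_pos hw0pos 2)]
    calc w0 ^ 2 * (ψ U * ψ U) = (ψ U * w0) * (ψ U * w0) := by ring
      _ ≤ (ψ U * ψ U) * Real.exp (-(β / 2) * wilsonAction su2Rep U) ^ 2 := by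
          rw [show (ψ U * w0) * (ψ U * w0) = (ψ U * ψ U) * w0 ^ 2 by ring]
          exact mul_le_mul_of_nonneg_left (pow_le_pow_left₀ hw0pos.le hwU 2) hψ2
      _ = _ := by ring
  have hle : l2 ψ ψ ≤ (w0 ^ 2)⁻¹ * l2 Φ Φ := by
    unfold l2
    rw [← integral_const_mul]
    exact integral_mono (hψ.integrable_mul hψ) ((hΦ.integrable_mul hΦ).const_mul _) hptw
  rw [hl2Φ, mul_zero] at hle
  exact absurd hle (not_le.mpr hpos)

/-- For `β > 0` and physical `ψ`: `⟨ψ, K_β ψ⟩ = 0 ↔ ‖ψ‖² = 0`. [cite: Luscher1977, §3] -/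
theorem qform_su2Rep_eq_zero_iff {β : ℝ} (hβ : 0 < β) {ψ : GaugeConfig 3 L SU2 → ℝ} (hψ : IsPhys ψ) :
    qform su2Rep β ψ ψ = 0 ↔ l2 ψ ψ = 0 := by
  constructor
  · intro h
    by_contra hne
    have hpos : 0 < l2 ψ ψ := (l2_self_nonneg ψ).lt_of_ne (Ne.symm hne)
    exact (qform_su2Rep_pos hβ hψ hpos).ne' h
  · intro h
    have hcs := sq_l2_le hψ (isPhys_transferApply β hψ)
    rw [h, zero_mul] at hcs
    rw [qform_eq_l2_transferApply]
    exact pow_eq_zero_iff two_ne_zero |>.mp (le_antisymm hcs (sq_nonneg _))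

/-- **Strict Rayleigh bound**: every physical Rayleigh quotient is strictly positive for `β > 0`. [cite: Luscher1977, §3] -/
theorem rayleigh_su2Rep_pos {β : ℝ} (hβ : 0 < β) {P : (GaugeConfig 3 L SU2 → ℝ) → Prop} {r : ℝ}
    (hr : r ∈ rayleighSet su2Rep L β P) : 0 < r := by
  obtain ⟨ψ, hψ, -, hpos, rfl⟩ := hr
  exact div_pos (qform_su2Rep_pos hβ hψ hpos) hpos

end Wilson

end Summit.QuantumFields.YangMills.Theorems.FemtoTransferGap

end
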